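import Summits.QuantumFields.YangMills.Theorems.F4SubCurvatureDoorShortRootRigidityTorusNoBadModes
import Summits.QuantumFields.YangMills.Theorems.F4SubCurvatureDoorShortRootRigidityOddModeAnalyticHalfUnfolded
import Summits.QuantumFields.YangMills.Theorems.F4SubCurvatureDoorShortRootRigidityPlanarRigidity
import Mathlib
import HarnessLib

/-!
# Crux ⟨stmt-QuantumFields-23035⟩ `F4SubCurvatureDoor.ShortRootRigidity`, PROVED

Route `F4SubCurvatureDoor` (sub-problem `YangMills`), LINE g21-C «aperture bootstrap» (planner ym-idea-3; skeleton
`Cruxes/ShortRootRigidity/Lines/aperture_bootstrap.lean`).  The last open stub `:146 stub_oddModeRigidity` is the composition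
`OddModeRigidity ⇐ AnalyticHalf ∧ TorusReduction` (the typed split `Lines/odd_mode_split.lean`; trigonal injectivity is consumed inside
`TorusReduction`), both now tree theorems in UNFOLDED form:

* analytic half — ✓`isometry_invariant_of_noBadModes` (`…OddModeAnalyticHalfUnfolded`, seat frs-p2 g16);
* `NoBadModes L` for every `L` — ✓`noBadModes_unfolded` (`…TorusNoBadModes`, this seat; over ✓`transverse_harmonic_eq_zero` of w5 g20 and
  ✓`trigonalInjectivityQ_holds` of w3 g38 / frs-p2, the ladder `…TorusLadder/Fischer/SliceAlgebra/Slice3/Generator`).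

Hence `oddModeRigidity_unfolded`, and — through ✓`shortRootRigidity_of_oddModeRigidity` (`…PlanarRigidity`, LEAD g75: the skeleton's
`shortRootRigidity_of_pieces` with the other four registered stubs landed by name) — the route crux `ShortRootRigidity` BY NAME
(`shortRootRigidity_proof`); its child crux `RationalToGeneral := RationalShortRootRigidity → ShortRootRigidity` follows in one line
(sibling file `F4SubCurvatureDoorRationalToGeneral.lean`).

Mathlib + tree only; no `sorry`; no new definitions; standard axioms.  HONEST LABEL: one crux item of route `F4SubCurvatureDoor` is closed (its child ⟨23125⟩ in the sibling file);
the route's other cruxes (`TrialityLimit` ⟨22566⟩, `SubCurvatureKernel` ⟨23036⟩, `NPointStepF4` ⟨23037⟩), the rung R2d (`BalabanLadder.ROT`)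
and every summit statement remain OPEN — the Yang–Mills mass gap is NOT proved; no summit is proved by a line.  LEAD seat `ym-line-sfw-p2` g76
(cell ym-idea-1, free hands; own crux ⟨22884⟩ line-dead, not refuted), by the owner's ruling (ym-idea-3 g23, 16:29:51Z).
-/

noncomputable section

namespace Summit.QuantumFields.YangMills.Theorems.F4SubCurvatureDoorTorus

open Summit.QuantumFields.YangMills.Theorems.F4SubCurvatureDoorMirrorAnalyticityRegistered (E4 InClass)
open Summit.QuantumFields.YangMills.Theorems.F4SubCurvatureDoorSliceDensityRegistered (EvenPartSliceInvariant)
open Summit.QuantumFields.YangMills.Theorems.F4SubCurvatureDoorAnalyticHalfProof (isometry_invariant_of_noBadModes)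
open Summit.QuantumFields.YangMills.Theorems.F4SubCurvatureDoorPlanarRigidityByName (shortRootRigidity_of_oddModeRigidity)

/-- **Odd-mode rigidity, unfolded** (the body of the registered stub `:146 stub_oddModeRigidity`, character for character): every kernel
of the class `InClass` whose even part is slice-invariant along `Π₀` is invariant under every linear isometry of `ℝ⁴`. -/
theorem oddModeRigidity_unfolded :
    ∀ K : E4 → ℝ, InClass K → EvenPartSliceInvariant K → ∀ (R : E4 ≃ₗᵢ[ℝ] E4) (x : E4), K (R x) = K x :=
  fun _ hK hE R x => isometry_invariant_of_noBadModes noBadModes_unfolded hK.1 hK.2.2.1 hE R x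

/-- **Crux ⟨stmt-QuantumFields-23035⟩ `ShortRootRigidity` of route `F4SubCurvatureDoor`, BY NAME.**  A kernel on `ℝ⁴` which is continuous
off the origin, bounded outside the unit ball, `W(B₄)`-invariant, reflection positive across `x₀ = 0`, of sub-curvature growth and
`W(F₄)`-invariant on a punctured ball is invariant there under every linear isometry. -/
theorem shortRootRigidity_proof : Summit.QuantumFields.YangMills.Theses.F4SubCurvatureDoor.ShortRootRigidity :=
  shortRootRigidity_of_oddModeRigidity oddModeRigidity_unfolded

end Summit.QuantumFields.YangMills.Theorems.F4SubCurvatureDoorTorus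

end
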